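import Mathlib
import Summits.HubbardSuperconductivity.HubbardSuperconductivity.Theorems.KLProgrammeCountPairsOffset
import Summits.HubbardSuperconductivity.HubbardSuperconductivity.Theorems.KLProgrammeH10TwoPointLimitSectorCount2nShellForms
import HarnessLib

/-!
# Route KLProgramme — crux K1 `H10TwoPointLimit`: the `2n`-leg sector counts, UNCONDITIONAL

The support item `CountPairsOffset` (stmt-HubbardSuperconductivity-20036) is closed (`CountPairsOffset_proof`,
`KLProgrammeCountPairsOffset.lean`), so the sector-language counts that were stated conditionally on the route decl
(`h10_twoNSectorCount_of_countPairsOffset`, `KLProgrammeH10TwoPointLimitSectorCount2n.lean`; the thick-shell master form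
`h10_twoNSectorCount_subset_of_countPairsOffset` with conservation slack, `…SectorCount2nShell.lean`; its exact-conservation
instances `…_constrained/_thick/_perturbed_of_countPairsOffset`, `…SectorCount2nShellForms.lean`) now hold outright: for
every level window `[μ₁, μ₂] ⊂ (-4, 0)`, every number `m` of fixed legs (and every thickness `c`, slack `s`), the number of
sector triples of width `π/2ⁿ` admitting shell momenta in the prescribed sectors with `Σ k = 2πG` (exactly, or within
`s·w`) is `≤ K·2ⁿ·(n+1)` — Benfatto–Giuliani–Mastropietro's `Cγ^{-h}|h|` (Lemma 3.1 / (A2.0)) at EVERY leg number on the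
whole hole-doped band, umklapp included. Helper for stub `stub_H10_mu_of_count` of K1 (stmt-HubbardSuperconductivity-19938).
-/

open Classical

noncomputable section

-- the tree's namespace `Summit.<Summit>.<Problem>.Theorems` repeats the summit name by design (D-0017)
set_option linter.dupNamespace false

open Real Set Literature.MathematicalPhysics.QuantumLattice Literature.MathematicalPhysics.QuantumLattice.BandSectorCounting

namespace Summit.HubbardSuperconductivity.HubbardSuperconductivity.Theorems

/-- **The `2n`-leg isotropic sector count modulo `2πℤ²` (DECOMP App. F Cor. F.3), unconditional**: for every window
`[μ₁, μ₂] ⊂ (-4, 0)` and every number `m` of fixed legs there is `K > 0` such that for all `μ ∈ [μ₁, μ₂]`, scales `n`,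
`G ∈ ℤ²` and fixed sectors `ω_f`, the number of sector triples (width `π/2ⁿ`) admitting momenta of the shell `|ε - μ| ≤ π/2ⁿ`
in the `m` fixed sectors and in the three counted ones with `Σ k = 2πG` is `≤ K·2ⁿ·(n+1)` (Benfatto–Giuliani–Mastropietro
2006, Lemma 3.1 / (A2.0), at every leg number `m + 3`). -/
theorem h10_twoNSectorCount :
    ∀ μ₁ μ₂ : ℝ, -4 < μ₁ → μ₁ ≤ μ₂ → μ₂ < 0 → ∀ m : ℕ, ∃ K : ℝ, 0 < K ∧
      ∀ μ ∈ Set.Icc μ₁ μ₂, ∀ (n : ℕ) (G : Fin 2 → ℤ) (ωf : Fin m → ℕ),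
        (((Finset.univ : Finset (Fin (sectorCount n) × Fin (sectorCount n) × Fin (sectorCount n))).filter
          (fun ω : Fin (sectorCount n) × Fin (sectorCount n) × Fin (sectorCount n) =>
            ∃ (kf : Fin m → Fin 2 → ℝ) (k : Fin 3 → Fin 2 → ℝ),
            (∀ j i, |kf j i| < Real.pi) ∧ (∀ l i, |k l i| < Real.pi) ∧
            (∀ j, |sqDispersion (kf j) - μ| ≤ sectorWidth n) ∧ (∀ l, |sqDispersion (k l) - μ| ≤ sectorWidth n) ∧
            (∀ j, sectorIndex n (Complex.arg (⟨kf j 0, kf j 1⟩ : ℂ)) = ωf j) ∧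
            sectorIndex n (Complex.arg (⟨k 0 0, k 0 1⟩ : ℂ)) = (ω.1 : ℕ) ∧
            sectorIndex n (Complex.arg (⟨k 1 0, k 1 1⟩ : ℂ)) = (ω.2.1 : ℕ) ∧
            sectorIndex n (Complex.arg (⟨k 2 0, k 2 1⟩ : ℂ)) = (ω.2.2 : ℕ) ∧
            (∀ i, (∑ j, kf j i) + (∑ l, k l i) = 2 * Real.pi * (G i : ℝ)))).card : ℝ) ≤
          K * 2 ^ n * ((n : ℝ) + 1) :=
  h10_twoNSectorCount_of_countPairsOffset CountPairsOffset_proof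

/-- **The master count, unconditional**: arbitrary per-leg momentum constraints implying the thick free shell
`|ε - μ| ≤ c·w` AND approximate conservation `|Σ k - 2πG|_∞ ≤ s·w` (`w = π/2ⁿ`; any reals `c`, `s`): `≤ K·2ⁿ·(n+1)` sector
triples, `K = K(μ₁, μ₂, m, c, s)`. -/
theorem h10_twoNSectorCount_subset :
    ∀ μ₁ μ₂ : ℝ, -4 < μ₁ → μ₁ ≤ μ₂ → μ₂ < 0 → ∀ (m : ℕ) (c s : ℝ), ∃ K : ℝ, 0 < K ∧
      ∀ μ ∈ Set.Icc μ₁ μ₂, ∀ (n : ℕ) (G : Fin 2 → ℤ) (ωf : Fin m → ℕ)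
        (Sf : Fin m → (Fin 2 → ℝ) → Prop) (S : Fin 3 → (Fin 2 → ℝ) → Prop),
        (∀ j k, (∀ i, |k i| < Real.pi) → Sf j k → |sqDispersion k - μ| ≤ c * sectorWidth n) →
        (∀ l k, (∀ i, |k i| < Real.pi) → S l k → |sqDispersion k - μ| ≤ c * sectorWidth n) →
        (((Finset.univ : Finset (Fin (sectorCount n) × Fin (sectorCount n) × Fin (sectorCount n))).filter
          (fun ω : Fin (sectorCount n) × Fin (sectorCount n) × Fin (sectorCount n) =>
            ∃ (kf : Fin m → Fin 2 → ℝ) (k : Fin 3 → Fin 2 → ℝ),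
            (∀ j i, |kf j i| < Real.pi) ∧ (∀ l i, |k l i| < Real.pi) ∧
            (∀ j, Sf j (kf j)) ∧ (∀ l, S l (k l)) ∧
            (∀ j, sectorIndex n (Complex.arg (⟨kf j 0, kf j 1⟩ : ℂ)) = ωf j) ∧
            sectorIndex n (Complex.arg (⟨k 0 0, k 0 1⟩ : ℂ)) = (ω.1 : ℕ) ∧
            sectorIndex n (Complex.arg (⟨k 1 0, k 1 1⟩ : ℂ)) = (ω.2.1 : ℕ) ∧
            sectorIndex n (Complex.arg (⟨k 2 0, k 2 1⟩ : ℂ)) = (ω.2.2 : ℕ) ∧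
            (∀ i, |(∑ j, kf j i) + (∑ l, k l i) - 2 * Real.pi * (G i : ℝ)| ≤ s * sectorWidth n))).card : ℝ) ≤
          K * 2 ^ n * ((n : ℝ) + 1) :=
  h10_twoNSectorCount_subset_of_countPairsOffset CountPairsOffset_proof

/-- **Arbitrary leg constraints inside the thick shell, exact conservation, unconditional.** -/
theorem h10_twoNSectorCount_constrained :
    ∀ μ₁ μ₂ : ℝ, -4 < μ₁ → μ₁ ≤ μ₂ → μ₂ < 0 → ∀ (m : ℕ) (c : ℝ), ∃ K : ℝ, 0 < K ∧
      ∀ μ ∈ Set.Icc μ₁ μ₂, ∀ (n : ℕ) (G : Fin 2 → ℤ) (ωf : Fin m → ℕ)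
        (Sf : Fin m → (Fin 2 → ℝ) → Prop) (S : Fin 3 → (Fin 2 → ℝ) → Prop),
        (∀ j k, (∀ i, |k i| < Real.pi) → Sf j k → |sqDispersion k - μ| ≤ c * sectorWidth n) →
        (∀ l k, (∀ i, |k i| < Real.pi) → S l k → |sqDispersion k - μ| ≤ c * sectorWidth n) →
        (((Finset.univ : Finset (Fin (sectorCount n) × Fin (sectorCount n) × Fin (sectorCount n))).filter
          (fun ω : Fin (sectorCount n) × Fin (sectorCount n) × Fin (sectorCount n) =>
            ∃ (kf : Fin m → Fin 2 → ℝ) (k : Fin 3 → Fin 2 → ℝ),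
            (∀ j i, |kf j i| < Real.pi) ∧ (∀ l i, |k l i| < Real.pi) ∧
            (∀ j, Sf j (kf j)) ∧ (∀ l, S l (k l)) ∧
            (∀ j, sectorIndex n (Complex.arg (⟨kf j 0, kf j 1⟩ : ℂ)) = ωf j) ∧
            sectorIndex n (Complex.arg (⟨k 0 0, k 0 1⟩ : ℂ)) = (ω.1 : ℕ) ∧
            sectorIndex n (Complex.arg (⟨k 1 0, k 1 1⟩ : ℂ)) = (ω.2.1 : ℕ) ∧
            sectorIndex n (Complex.arg (⟨k 2 0, k 2 1⟩ : ℂ)) = (ω.2.2 : ℕ) ∧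
            (∀ i, (∑ j, kf j i) + (∑ l, k l i) = 2 * Real.pi * (G i : ℝ)))).card : ℝ) ≤
          K * 2 ^ n * ((n : ℝ) + 1) :=
  h10_twoNSectorCount_constrained_of_countPairsOffset CountPairsOffset_proof

/-- **(a) The thick shell `|ε - μ| ≤ c·π/2ⁿ`, unconditional** (AUDIT-A1A2 §2 row 2.12 (a) at every leg number). -/
theorem h10_twoNSectorCount_thick :
    ∀ μ₁ μ₂ : ℝ, -4 < μ₁ → μ₁ ≤ μ₂ → μ₂ < 0 → ∀ (m : ℕ) (c : ℝ), ∃ K : ℝ, 0 < K ∧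
      ∀ μ ∈ Set.Icc μ₁ μ₂, ∀ (n : ℕ) (G : Fin 2 → ℤ) (ωf : Fin m → ℕ),
        (((Finset.univ : Finset (Fin (sectorCount n) × Fin (sectorCount n) × Fin (sectorCount n))).filter
          (fun ω : Fin (sectorCount n) × Fin (sectorCount n) × Fin (sectorCount n) =>
            ∃ (kf : Fin m → Fin 2 → ℝ) (k : Fin 3 → Fin 2 → ℝ),
            (∀ j i, |kf j i| < Real.pi) ∧ (∀ l i, |k l i| < Real.pi) ∧
            (∀ j, |sqDispersion (kf j) - μ| ≤ c * sectorWidth n) ∧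
            (∀ l, |sqDispersion (k l) - μ| ≤ c * sectorWidth n) ∧
            (∀ j, sectorIndex n (Complex.arg (⟨kf j 0, kf j 1⟩ : ℂ)) = ωf j) ∧
            sectorIndex n (Complex.arg (⟨k 0 0, k 0 1⟩ : ℂ)) = (ω.1 : ℕ) ∧
            sectorIndex n (Complex.arg (⟨k 1 0, k 1 1⟩ : ℂ)) = (ω.2.1 : ℕ) ∧
            sectorIndex n (Complex.arg (⟨k 2 0, k 2 1⟩ : ℂ)) = (ω.2.2 : ℕ) ∧
            (∀ i, (∑ j, kf j i) + (∑ l, k l i) = 2 * Real.pi * (G i : ℝ)))).card : ℝ) ≤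
          K * 2 ^ n * ((n : ℝ) + 1) :=
  h10_twoNSectorCount_thick_of_countPairsOffset CountPairsOffset_proof

/-- **(b) Perturbed per-leg dispersions, unconditional** (AUDIT-A1A2 §2 row 2.12 (b) / GAP-LEDGER G-002 at every leg number:
`sup |ε' - ε| ≤ δ`, shells `|ε' - μ| ≤ t`, `t + δ ≤ c·π/2ⁿ` — the moving Fermi curve of Benfatto–Giuliani–Mastropietro's
scale-`h` dispersion costs nothing in the sector counts). -/
theorem h10_twoNSectorCount_perturbed :
    ∀ μ₁ μ₂ : ℝ, -4 < μ₁ → μ₁ ≤ μ₂ → μ₂ < 0 → ∀ (m : ℕ) (c : ℝ), ∃ K : ℝ, 0 < K ∧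
      ∀ μ ∈ Set.Icc μ₁ μ₂, ∀ (n : ℕ) (G : Fin 2 → ℤ) (ωf : Fin m → ℕ)
        (εf : Fin m → (Fin 2 → ℝ) → ℝ) (ε' : Fin 3 → (Fin 2 → ℝ) → ℝ) (t δ : ℝ),
        (∀ j k, (∀ i, |k i| < Real.pi) → |εf j k - sqDispersion k| ≤ δ) →
        (∀ l k, (∀ i, |k i| < Real.pi) → |ε' l k - sqDispersion k| ≤ δ) →
        t + δ ≤ c * sectorWidth n →
        (((Finset.univ : Finset (Fin (sectorCount n) × Fin (sectorCount n) × Fin (sectorCount n))).filter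
          (fun ω : Fin (sectorCount n) × Fin (sectorCount n) × Fin (sectorCount n) =>
            ∃ (kf : Fin m → Fin 2 → ℝ) (k : Fin 3 → Fin 2 → ℝ),
            (∀ j i, |kf j i| < Real.pi) ∧ (∀ l i, |k l i| < Real.pi) ∧
            (∀ j, |εf j (kf j) - μ| ≤ t) ∧ (∀ l, |ε' l (k l) - μ| ≤ t) ∧
            (∀ j, sectorIndex n (Complex.arg (⟨kf j 0, kf j 1⟩ : ℂ)) = ωf j) ∧
            sectorIndex n (Complex.arg (⟨k 0 0, k 0 1⟩ : ℂ)) = (ω.1 : ℕ) ∧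
            sectorIndex n (Complex.arg (⟨k 1 0, k 1 1⟩ : ℂ)) = (ω.2.1 : ℕ) ∧
            sectorIndex n (Complex.arg (⟨k 2 0, k 2 1⟩ : ℂ)) = (ω.2.2 : ℕ) ∧
            (∀ i, (∑ j, kf j i) + (∑ l, k l i) = 2 * Real.pi * (G i : ℝ)))).card : ℝ) ≤
          K * 2 ^ n * ((n : ℝ) + 1) :=
  h10_twoNSectorCount_perturbed_of_countPairsOffset CountPairsOffset_proof

end Summit.HubbardSuperconductivity.HubbardSuperconductivity.Theorems

end
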